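import Mathlib.NumberTheory.Padics.PadicNumbers
import Mathlib.LinearAlgebra.Matrix.NonsingularInverse
import Mathlib.LinearAlgebra.Matrix.ToLin
import Mathlib.RingTheory.TensorProduct.Maps
import Literature.NumberTheory.GaloisRepresentations.WeaklyAdmissible
import HarnessLib

/-!
# Berger's rank-two filtered `φ`-modules `D_{k,a_p}` over `ℚ_p`

The explicit representatives of the two-parameter family of rank-`2` filtered `φ`-modules over
`K = ℚ_p` with coefficients in a finite extension `E/ℚ_p` (Breuil, Berger–Li–Zhu, Berger):
for an integer `k` (intended `k ≥ 2`) and `a_p ∈ E` (intended `a_p ∈ 𝔪_E`),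
`D_{k,a_p} = E e₁ ⊕ E e₂` with

  `φ(e₁) = p^{k-1} e₂`, `φ(e₂) = -e₁ + a_p e₂`,
  `Filⁱ D_{k,a_p} = D_{k,a_p}` (`i ≤ 0`), `= E e₁` (`1 ≤ i ≤ k - 1`), `= 0` (`i ≥ k`)

(Berger2011, §1), as an object `bergerModule E k a` of
`FilteredPhiModule ℚ_[p] (RingHom.id ℚ_[p]) E` (file `WeaklyAdmissible.lean`: base
`F₀ = P = ℚ_p`, `σ = id`).  By Colmez–Fontaine there is a crystalline `E`-representation
`V_{k,a_p}` of `Gal(ℚ̄_p/ℚ_p)` with `D_cris(V_{k,a_p}^*) = D_{k,a_p}`, irreducible with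
Hodge–Tate weights `0, k - 1` for `k ≥ 2`, `a_p ∈ 𝔪_E` (Berger2011 §1); relative to a
crystalline period-ring datum it is (the dual of)
`(bergerModule E k a).crystallineRepOfWeaklyAdmissible 𝔅 hσ`.  These `V_{k,a_p}` parametrise,
up to twist, all irreducible `2`-dimensional crystalline representations of `G_{ℚ_p}`, and are
the objects of the reduction / local-constancy literature (Berger2011 Thm. A, Rozensztajn2020,
BuzzardGee2009, BergerLiJunezhu2004).

## Main definitions and results

* `bergerMatrix k a = !![0, -1; p^{k-1}, a]`: the matrix of `φ` (columns = images of `e₁, e₂`).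
* `bergerFil E k i`: the filtration (`⊤` / `E e₁` / `⊥`).
* `bergerModule E k a : FilteredPhiModule ℚ_[p] (RingHom.id ℚ_[p]) E` with carrier `Fin 2 → E`.
* API: `det_bergerMatrix`, `isUnit_bergerMatrix`, `bergerModule_phi_apply`,
  `bergerModule_phi_single_zero/one` (`φ e₁ = p^{k-1} e₂`, `φ e₂ = -e₁ + a e₂`),
  `bergerFil_of_nonpos/_of_pos_of_le/_of_lt`, `bergerFil_antitone`, `bergerModule_fil`,
  `bergerModule_isFreeOfRank` (`D_{k,a_p}` is free of rank `2` over `ℚ_p ⊗_{ℚ_p} E`).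

## Design notes

* `k : ℕ` and the exponent `k - 1` is natural-number subtraction: for the junk value `k = 0` the
  matrix is `!![0, -1; 1, a]` and the filtration has no intermediate step (same as `k = 1`);
  Berger assumes `k ≥ 2`.  No condition on `a` is imposed by the definition (weak admissibility
  holds iff `a ∈ 𝓞_E`; irreducibility of `V_{k,a_p}` needs `a ∈ 𝔪_E`), since the object
  `D_{k,a}` makes sense for every `a`.
* `[FiniteDimensional ℚ_[p] E]` is needed for the finiteness field of `FilteredPhiModule`.
* Weak admissibility of `D_{k,a_p}` for `a_p ∈ 𝓞_E`, `k ≥ 1` (a computation with `φ`-stable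
  `ℚ_p`-subspaces of `E²`) is NOT proved here.

## References

* L. Berger, *Local constancy for the reduction mod p of 2-dimensional crystalline
  representations*, Bull. LMS 44 (2012) / arXiv:0907.0221, §1. [Berger2011]
* L. Berger, H. Li, H. J. Zhu, Math. Ann. 329 (2004), §1. [BergerLiJunezhu2004]
-/

noncomputable section

open scoped TensorProduct
open Matrix

namespace Literature.NumberTheory.GaloisRepresentations

universe u

variable {p : ℕ} (E : Type u) [Field E]

/-- The matrix `!![0, -1; p^{k-1}, a]` of Berger's Frobenius on `D_{k,a_p}` in the basis
`e₁, e₂` (acting on column vectors: `φ e₁ = p^{k-1} e₂`, `φ e₂ = -e₁ + a e₂`).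
Ref: Berger2011, §1. [cite: Berger2011, §1] -/
def bergerMatrix (k : ℕ) (a : E) : Matrix (Fin 2) (Fin 2) E :=
  !![0, -1; (p : E) ^ (k - 1), a]

/-- `det !![0, -1; p^{k-1}, a] = p^{k-1}`. [folklore] -/
lemma det_bergerMatrix (k : ℕ) (a : E) : (bergerMatrix (p := p) E k a).det = (p : E) ^ (k - 1) := by
  rw [bergerMatrix, Matrix.det_fin_two_of]
  ring

variable [Fact p.Prime] [Algebra ℚ_[p] E]

/-- Berger's matrix is invertible: its determinant `p^{k-1}` is nonzero, `E` having
characteristic zero as a `ℚ_p`-algebra. [folklore] -/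
lemma isUnit_bergerMatrix (k : ℕ) (a : E) : IsUnit (bergerMatrix (p := p) E k a) := by
  haveI : CharZero E := charZero_of_injective_algebraMap (algebraMap ℚ_[p] E).injective
  rw [Matrix.isUnit_iff_isUnit_det, det_bergerMatrix, isUnit_iff_ne_zero]
  exact pow_ne_zero _ (Nat.cast_ne_zero.mpr (Fact.out : p.Prime).ne_zero)

/-- Berger's Hodge filtration on `E² = E e₁ ⊕ E e₂`: `Filⁱ = E²` for `i ≤ 0`, `Filⁱ = E e₁` for
`1 ≤ i ≤ k - 1`, `Filⁱ = 0` for `i ≥ k` (as `ℚ_p`-subspaces; each is an `E`-subspace).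
Ref: Berger2011, §1. [cite: Berger2011, §1] -/
def bergerFil (k : ℕ) (i : ℤ) : Submodule ℚ_[p] (Fin 2 → E) :=
  if i ≤ 0 then ⊤
  else if i ≤ (k : ℤ) - 1 then (Submodule.span E {Pi.single (0 : Fin 2) (1 : E)}).restrictScalars ℚ_[p]
  else ⊥

/-- `Filⁱ = E²` for `i ≤ 0`. [folklore] -/
@[simp] lemma bergerFil_of_nonpos (k : ℕ) {i : ℤ} (hi : i ≤ 0) :
    bergerFil (p := p) E k i = ⊤ := if_pos hi

/-- `Filⁱ = E e₁` for `1 ≤ i ≤ k - 1`. [folklore] -/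
lemma bergerFil_of_pos_of_le (k : ℕ) {i : ℤ} (hi : 0 < i) (hik : i ≤ (k : ℤ) - 1) :
    bergerFil (p := p) E k i =
      (Submodule.span E {Pi.single (0 : Fin 2) (1 : E)}).restrictScalars ℚ_[p] := by
  rw [bergerFil, if_neg (not_le.mpr hi), if_pos hik]

/-- `Filⁱ = 0` for `i > max (k - 1, 0)`, i.e. `i ≥ k` (and `i ≥ 1`). [folklore] -/
lemma bergerFil_of_lt (k : ℕ) {i : ℤ} (hi : 0 < i) (hik : (k : ℤ) - 1 < i) :
    bergerFil (p := p) E k i = ⊥ := by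
  rw [bergerFil, if_neg (not_le.mpr hi), if_neg (not_le.mpr hik)]

/-- Berger's filtration is decreasing. [folklore] -/
lemma bergerFil_antitone (k : ℕ) : Antitone (bergerFil (p := p) E k) := by
  intro i j hij
  by_cases hi : i ≤ 0
  · rw [bergerFil_of_nonpos E k hi]
    exact le_top
  have hj : 0 < j := lt_of_lt_of_le (not_le.mp hi) hij
  by_cases hjk : (k : ℤ) - 1 < j
  · rw [bergerFil_of_lt E k hj hjk]
    exact bot_le
  rw [bergerFil_of_pos_of_le E k hj (not_lt.mp hjk),
    bergerFil_of_pos_of_le E k (not_le.mp hi) (le_trans hij (not_lt.mp hjk))]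

variable [FiniteDimensional ℚ_[p] E]

/-- **Berger's filtered `φ`-module `D_{k,a_p}`** over `ℚ_p` with coefficients in the finite
extension `E/ℚ_p`: carrier `E² = (Fin 2 → E)` with basis `e₁ = Pi.single 0 1`,
`e₂ = Pi.single 1 1`; Frobenius the `E`-linear map with matrix `!![0, -1; p^{k-1}, a]`
(`φ e₁ = p^{k-1} e₂`, `φ e₂ = -e₁ + a e₂`), bijective since `p ≠ 0` in `E`; filtration
`bergerFil` (`E²` / `E e₁` in degrees `1 … k-1` / `0`).  Base `F₀ = P = ℚ_p`, `σ = id`.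
By Colmez–Fontaine, for `k ≥ 2` and `a ∈ 𝔪_E` there is a crystalline irreducible
`E`-representation `V_{k,a_p}` of `G_{ℚ_p}` with Hodge–Tate weights `0, k-1` and
`D_cris(V_{k,a_p}^*) = D_{k,a_p}` (Berger2011 §1); every irreducible `2`-dimensional
crystalline representation is a twist of some `V_{k,a_p}`.
Ref: Berger2011, §1 (definition of `D_{k,a_p}`); BergerLiJunezhu2004 §1. [cite: Berger2011, §1] -/
def bergerModule (k : ℕ) (a : E) : FilteredPhiModule.{u, 0, 0, u} ℚ_[p] (RingHom.id ℚ_[p]) E where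
  carrier := Fin 2 → E
  phi := (Matrix.mulVecLin (bergerMatrix E k a)).restrictScalars ℚ_[p]
  phi_smul e x := (Matrix.mulVecLin (bergerMatrix E k a)).map_smul e x
  phi_bijective :=
    show Function.Bijective (bergerMatrix (p := p) E k a).mulVec from
      ⟨Matrix.mulVec_injective_iff_isUnit.mpr (isUnit_bergerMatrix (p := p) E k a),
        Matrix.mulVec_surjective_iff_isUnit.mpr (isUnit_bergerMatrix (p := p) E k a)⟩
  fil := bergerFil E k
  smul_mem_fil e i x hx := by
    by_cases hi : i ≤ 0
    · simp [hi]
    by_cases hik : (k : ℤ) - 1 < i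
    · rw [bergerFil_of_lt E k (not_le.mp hi) hik, Submodule.mem_bot] at hx
      simp [hx]
    rw [bergerFil_of_pos_of_le E k (not_le.mp hi) (not_lt.mp hik), Submodule.restrictScalars_mem]
      at hx ⊢
    exact Submodule.smul_mem _ e hx
  fil_antitone := bergerFil_antitone E k
  exists_fil_eq_top := ⟨0, bergerFil_of_nonpos E k le_rfl⟩
  exists_fil_eq_bot := ⟨(k : ℤ) + 1, bergerFil_of_lt E k (by omega) (by omega)⟩

variable {E}

/-- The carrier of `D_{k,a_p}` is `E²`. [folklore] -/
lemma bergerModule_carrier (k : ℕ) (a : E) :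
    (bergerModule (p := p) E k a : Type u) = (Fin 2 → E) := rfl

/-- Unfolding lemma: `φ` of `D_{k,a_p}` is multiplication by Berger's matrix. [folklore] -/
lemma bergerModule_phi_apply (k : ℕ) (a : E) (x : Fin 2 → E) :
    (bergerModule (p := p) E k a).phi x = bergerMatrix (p := p) E k a *ᵥ x := rfl

/-- `φ e₁ = p^{k-1} e₂`. [cite: Berger2011, §1] -/
lemma bergerModule_phi_single_zero (k : ℕ) (a : E) :
    (bergerModule (p := p) E k a).phi (Pi.single 0 1) = ((p : E) ^ (k - 1) • Pi.single 1 1 : Fin 2 → E) := by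
  rw [bergerModule_phi_apply]
  funext i
  fin_cases i <;> simp [bergerMatrix, Matrix.mulVec, dotProduct, Fin.sum_univ_two]

/-- `φ e₂ = -e₁ + a e₂`. [cite: Berger2011, §1] -/
lemma bergerModule_phi_single_one (k : ℕ) (a : E) :
    (bergerModule (p := p) E k a).phi (Pi.single 1 1) = (-Pi.single 0 1 + a • Pi.single 1 1 : Fin 2 → E) := by
  rw [bergerModule_phi_apply]
  funext i
  fin_cases i <;> simp [bergerMatrix, Matrix.mulVec, dotProduct, Fin.sum_univ_two]

/-- Unfolding lemma for the filtration of `D_{k,a_p}`. [folklore] -/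
lemma bergerModule_fil (k : ℕ) (a : E) (i : ℤ) :
    (bergerModule (p := p) E k a).fil i = bergerFil E k i := rfl

/-- `D_{k,a_p}` is free of rank `2` over `ℚ_p ⊗_{ℚ_p} E (≅ E)` (basis `e₁, e₂`, transported
along `TensorProduct.lid`).
Ref: Berger2011, §1 (`D_{k,a_p} = E e₁ ⊕ E e₂`). [cite: Berger2011, §1] -/
lemma bergerModule_isFreeOfRank (k : ℕ) (a : E) : (bergerModule (p := p) E k a).IsFreeOfRank 2 := by
  unfold FilteredPhiModule.IsFreeOfRank
  letI : Module (ℚ_[p] ⊗[ℚ_[p]] E) (bergerModule (p := p) E k a) :=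
    TensorProduct.Algebra.module (R := ℚ_[p]) (A := ℚ_[p]) (B := E) (M := bergerModule (p := p) E k a)
  have h : ∀ (c : E) (x : bergerModule (p := p) E k a),
      (Algebra.TensorProduct.lid ℚ_[p] E).symm.toRingEquiv c • x = c • x := fun c x => by
    change ((1 : ℚ_[p]) ⊗ₜ[ℚ_[p]] c) • x = c • x
    rw [TensorProduct.Algebra.smul_def, one_smul]
  let b₀ : Module.Basis (Fin 2) E (bergerModule (p := p) E k a) := Pi.basisFun E (Fin 2)
  let b : Module.Basis (Fin 2) (ℚ_[p] ⊗[ℚ_[p]] E) (bergerModule (p := p) E k a) :=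
    b₀.mapCoeffs (Algebra.TensorProduct.lid ℚ_[p] E).symm.toRingEquiv h
  exact ⟨Module.Free.of_basis b, (Module.finrank_eq_card_basis b).trans (Fintype.card_fin 2)⟩

end Literature.NumberTheory.GaloisRepresentations
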